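import Summits.ValiantsHypothesis.ValiantsHypothesis.Theorems.LacunarySymmetroidMatrixDescartesDoorA26WallBubblingOrderThreeOpening
import Literature.Analysis.Convex.ConvexInequalityAlternative

/-!
# `DoorA26` / line `wall_bubbling` — THE FIRST-ORDER DICHOTOMY FOR PROFILES OF ORDER ≤ 3: lift, or a generalized balance

HONEST FRAMING.  Object-search cell `pub-symmetroid`, crux `Theses.LacunarySymmetroid.DoorA26` (stmt-ValiantsHypothesis-19979; OPEN, typed,
never asserted).  W2 seat val-sym-door-p1 g20, file #81; def-free helper for obligation (R) of `Cruxes/DoorA26/Lines/wall_bubbling.lean`.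
Imports #80 `…OrderThreeOpening` (the primal opening) and the tree's Fan–Glicksberg–Hoffman / Rockafellar alternative
`Literature.Analysis.Convex.ConvexInequalityAlternative.not_exists_forall_lt_iff` (Theorem 21.1, proved there).

THE THEOREM (`mem_twentyLocus_or_generalizedBalance_orderThree`).  Symmetric letters, `F = det P`, separated points `z_j` of exact orders
`m_j ∈ {1,2,3}` with `Σ m_j ≥ 20` (as in #80).  Then EITHER `δ ∈ TwentyLocus`, OR there is a GENERALIZED BALANCE: multipliers `λ_j ≥ 0`, not all zero,
vanishing at the simple zeros, such that for EVERY coordinate shift `w` whose first variation `c₁ = det(P+Q) − det P − det Q` vanishes at all triple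
zeros, `Σ_j λ_j · F^{(m_j)}(z_j) · c₁^{(m_j − 2)}(z_j) = 0` (touches enter with `F″(z_j)c₁(z_j)`, triple zeros with `F‴(z_j)c₁′(z_j)`).  This is #47
`mem_twentyLocus_of_touches_noBalance` (touches only, on a 21-frame, via Gordan) extended to any number of TRIPLE zeros (equality rows ⇒ Rockafellar's
alternative on the subspace `{c₁(z_j) = 0 at the triple zeros}` instead of Gordan), frame-free.  It is LEVEL 1 of the obstruction tower of memo
`DOOR-A26-P1G20-NEWTON-LIFT.md` §2 for patterns `(3^a, 2^b, 1^c)`; g19's p⋆-centred no-balance analysis (memo g19 §7c) is a statement about exactly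
this balance.

WHAT IS HERE.  `coordLetter_linear`, ★ `iteratedDeriv_firstVariation_linear` (every jet of the first variation is linear in the 18 shift coordinates —
through the exponential-sum representation), ★★ `mem_twentyLocus_or_generalizedBalance_orderThree`.  Nothing here bears on `DoorA26`, `DoorA34`,
(W)/(M)/(R), `MatrixDescartes` (18050) or `VP ≠ VNP`; registers unchanged.

[cite: Rockafellar1970, §21 Thm 21.1] (the tree's Literature file; Fan–Glicksberg–Hoffman).  [this work] the dichotomy.
-/

set_option linter.dupNamespace false

namespace Summit.ValiantsHypothesis.ValiantsHypothesis.Theorems.LacunarySymmetroidMatrixDescartes.WallBubbling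

open Finset Filter Topology
open Bubbling (TwentyLocus expSum)

/-! ## §1 Linearity of the first variation in the shift coordinates -/

/-- The coordinate letters are linear in the coordinates (entrywise). [folklore] -/
theorem coordLetter_linear (a b : ℝ) (w w' : Fin 6 → Fin 3 → ℝ) (l : Fin 6) (i j : Fin 2) :
    (!![(a • w + b • w') l 0, (a • w + b • w') l 1; (a • w + b • w') l 1, (a • w + b • w') l 2] : Matrix (Fin 2) (Fin 2) ℝ) i j
      = a * (!![w l 0, w l 1; w l 1, w l 2] : Matrix (Fin 2) (Fin 2) ℝ) i j
        + b * (!![w' l 0, w' l 1; w' l 1, w' l 2] : Matrix (Fin 2) (Fin 2) ℝ) i j := by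
  fin_cases i <;> fin_cases j <;> simp

/-- ★ **Every jet of the first variation is linear in the shift coordinates.**  With `P` the pencil of `S` and `Q_w` the pencil of the coordinate
letters of `w`, `c₁(w) = det(P + Q_w) − det P − det Q_w` satisfies `c₁(aw + bw')^{(n)}(t) = a·c₁(w)^{(n)}(t) + b·c₁(w')^{(n)}(t)` for every `n, t`
(the three functions are exponential sums whose coefficients are linear in `w`; `iteratedDeriv_expSum`). [this work] -/
theorem iteratedDeriv_firstVariation_linear (δ : Fin 6 → ℝ) (S : Fin 6 → Matrix (Fin 2) (Fin 2) ℝ) (a b : ℝ) (w w' : Fin 6 → Fin 3 → ℝ)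
    (n : ℕ) (t : ℝ) :
    iteratedDeriv n (fun t => ((∑ l, Real.exp (δ l * t) • S l)
        + (∑ l, Real.exp (δ l * t) • (!![(a • w + b • w') l 0, (a • w + b • w') l 1; (a • w + b • w') l 1, (a • w + b • w') l 2] :
            Matrix (Fin 2) (Fin 2) ℝ))).det
        - (∑ l, Real.exp (δ l * t) • S l).det
        - (∑ l, Real.exp (δ l * t) • (!![(a • w + b • w') l 0, (a • w + b • w') l 1; (a • w + b • w') l 1, (a • w + b • w') l 2] :
            Matrix (Fin 2) (Fin 2) ℝ)).det) t
      = a * iteratedDeriv n (fun t => ((∑ l, Real.exp (δ l * t) • S l)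
            + (∑ l, Real.exp (δ l * t) • (!![w l 0, w l 1; w l 1, w l 2] : Matrix (Fin 2) (Fin 2) ℝ))).det
            - (∑ l, Real.exp (δ l * t) • S l).det
            - (∑ l, Real.exp (δ l * t) • (!![w l 0, w l 1; w l 1, w l 2] : Matrix (Fin 2) (Fin 2) ℝ)).det) t
        + b * iteratedDeriv n (fun t => ((∑ l, Real.exp (δ l * t) • S l)
            + (∑ l, Real.exp (δ l * t) • (!![w' l 0, w' l 1; w' l 1, w' l 2] : Matrix (Fin 2) (Fin 2) ℝ))).det
            - (∑ l, Real.exp (δ l * t) • S l).det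
            - (∑ l, Real.exp (δ l * t) • (!![w' l 0, w' l 1; w' l 1, w' l 2] : Matrix (Fin 2) (Fin 2) ℝ)).det) t := by
  classical
  -- exponential-sum representation (Leibniz index)
  let ι := Equiv.Perm (Fin 2) × (Fin 2 → Fin 6)
  let x : ι → ℝ := fun p => ∑ i, δ (p.2 i)
  let lb : (Fin 6 → Matrix (Fin 2) (Fin 2) ℝ) → ι → ℝ := fun U p => ((Equiv.Perm.sign p.1 : ℤ) : ℝ) * ∏ i, U (p.2 i) (p.1 i) i
  have ev : ∀ (U : Fin 6 → Matrix (Fin 2) (Fin 2) ℝ) (t : ℝ), (∑ l, Real.exp (δ l * t) • U l).det = expSum (lb U) x t :=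
    fun U t => congrFun (det_expPencil_eq_expSum_fun δ U) t
  let Tw : (Fin 6 → Fin 3 → ℝ) → Fin 6 → Matrix (Fin 2) (Fin 2) ℝ := fun w l => !![w l 0, w l 1; w l 1, w l 2]
  -- the first variation of the shift `w` as an exponential sum, with coefficients linear in `w`
  let a1 : (Fin 6 → Fin 3 → ℝ) → ι → ℝ := fun w p =>
    ((Equiv.Perm.sign p.1 : ℤ) : ℝ) * (S (p.2 0) (p.1 0) 0 * Tw w (p.2 1) (p.1 1) 1 + Tw w (p.2 0) (p.1 0) 0 * S (p.2 1) (p.1 1) 1)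
  have ha1 : ∀ (w : Fin 6 → Fin 3 → ℝ) (p : ι), lb (fun l => S l + Tw w l) p - lb S p - lb (Tw w) p = a1 w p := by
    intro w p
    simp only [lb, a1, Fin.prod_univ_two, Matrix.add_apply]
    ring
  have hrep : ∀ w : Fin 6 → Fin 3 → ℝ, (fun t => ((∑ l, Real.exp (δ l * t) • S l) + (∑ l, Real.exp (δ l * t) • Tw w l)).det
        - (∑ l, Real.exp (δ l * t) • S l).det - (∑ l, Real.exp (δ l * t) • Tw w l).det) = expSum (a1 w) x := by
    intro w
    funext t
    rw [expPencil_add, ev, ev, ev, expSum_sub_sub]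
    unfold Bubbling.expSum
    exact Finset.sum_congr rfl fun p _ => by simp only [ha1]
  have hlin : ∀ p : ι, a1 (a • w + b • w') p = a * a1 w p + b * a1 w' p := by
    intro p
    simp only [a1, Tw, coordLetter_linear]
    ring
  have hTw : ∀ v : Fin 6 → Fin 3 → ℝ, (fun l => (!![v l 0, v l 1; v l 1, v l 2] : Matrix (Fin 2) (Fin 2) ℝ)) = Tw v := fun v => rfl
  show iteratedDeriv n (fun t => ((∑ l, Real.exp (δ l * t) • S l) + (∑ l, Real.exp (δ l * t) • Tw (a • w + b • w') l)).det
        - (∑ l, Real.exp (δ l * t) • S l).det - (∑ l, Real.exp (δ l * t) • Tw (a • w + b • w') l).det) t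
      = a * iteratedDeriv n (fun t => ((∑ l, Real.exp (δ l * t) • S l) + (∑ l, Real.exp (δ l * t) • Tw w l)).det
        - (∑ l, Real.exp (δ l * t) • S l).det - (∑ l, Real.exp (δ l * t) • Tw w l).det) t
        + b * iteratedDeriv n (fun t => ((∑ l, Real.exp (δ l * t) • S l) + (∑ l, Real.exp (δ l * t) • Tw w' l)).det
        - (∑ l, Real.exp (δ l * t) • S l).det - (∑ l, Real.exp (δ l * t) • Tw w' l).det) t
  rw [hrep, hrep, hrep, iteratedDeriv_expSum, iteratedDeriv_expSum, iteratedDeriv_expSum]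
  unfold Bubbling.expSum
  simp only [hlin]
  rw [Finset.mul_sum, Finset.mul_sum, ← Finset.sum_add_distrib]
  exact Finset.sum_congr rfl fun p _ => by ring

/-! ## §2 The dichotomy -/

/-- ★★ **FIRST-ORDER DICHOTOMY FOR PROFILES OF ORDER ≤ 3** (see the module docstring): `δ ∈ TwentyLocus`, or a generalized balance — non-negative
multipliers, not all zero, zero at the simple zeros, annihilating `Σ_j λ_j F^{(m_j)}(z_j) c₁(w)^{(m_j−2)}(z_j)` for every shift `w` whose first
variation vanishes at the triple zeros. [this work] -/
theorem mem_twentyLocus_or_generalizedBalance_orderThree (δ : Fin 6 → ℝ) (S : Fin 6 → Matrix (Fin 2) (Fin 2) ℝ) (hS : ∀ l, (S l).IsSymm)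
    {r : ℕ} (z : Fin r → ℝ) {ρ : ℝ} (hρ : 0 < ρ) (hsep : ∀ i j : Fin r, i < j → z i + ρ ≤ z j - ρ)
    (m : Fin r → ℕ) (hm1 : ∀ j, 1 ≤ m j) (hm3 : ∀ j, m j ≤ 3) (hm : 20 ≤ ∑ j, m j)
    (hvan : ∀ j, ∀ i < m j, iteratedDeriv i (fun t => (∑ l, Real.exp (δ l * t) • S l).det) (z j) = 0)
    (htop : ∀ j, iteratedDeriv (m j) (fun t => (∑ l, Real.exp (δ l * t) • S l).det) (z j) ≠ 0) :
    δ ∈ TwentyLocus ∨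
    ∃ lam : Fin r → ℝ, (∀ j, 0 ≤ lam j) ∧ lam ≠ 0 ∧ (∀ j, m j = 1 → lam j = 0) ∧
      ∀ w : Fin 6 → Fin 3 → ℝ,
        (∀ j, m j = 3 →
          (((∑ l, Real.exp (δ l * z j) • S l) + (∑ l, Real.exp (δ l * z j) • (!![w l 0, w l 1; w l 1, w l 2] : Matrix (Fin 2) (Fin 2) ℝ))).det
            - (∑ l, Real.exp (δ l * z j) • S l).det
            - (∑ l, Real.exp (δ l * z j) • (!![w l 0, w l 1; w l 1, w l 2] : Matrix (Fin 2) (Fin 2) ℝ)).det) = 0) →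
        ∑ j, lam j * (iteratedDeriv (m j) (fun t => (∑ l, Real.exp (δ l * t) • S l).det) (z j) *
          iteratedDeriv (m j - 2) (fun t => ((∑ l, Real.exp (δ l * t) • S l)
              + (∑ l, Real.exp (δ l * t) • (!![w l 0, w l 1; w l 1, w l 2] : Matrix (Fin 2) (Fin 2) ℝ))).det
            - (∑ l, Real.exp (δ l * t) • S l).det
            - (∑ l, Real.exp (δ l * t) • (!![w l 0, w l 1; w l 1, w l 2] : Matrix (Fin 2) (Fin 2) ℝ)).det) (z j)) = 0 := by
  classical
  set c₀ : ℝ → ℝ := fun t => (∑ l, Real.exp (δ l * t) • S l).det with hc₀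
  -- the first variation of a shift, as a function of `t`
  let C1 : (Fin 6 → Fin 3 → ℝ) → ℝ → ℝ := fun w t => ((∑ l, Real.exp (δ l * t) • S l)
      + (∑ l, Real.exp (δ l * t) • (!![w l 0, w l 1; w l 1, w l 2] : Matrix (Fin 2) (Fin 2) ℝ))).det
    - (∑ l, Real.exp (δ l * t) • S l).det
    - (∑ l, Real.exp (δ l * t) • (!![w l 0, w l 1; w l 1, w l 2] : Matrix (Fin 2) (Fin 2) ℝ)).det
  have hL : ∀ (a b : ℝ) (w w' : Fin 6 → Fin 3 → ℝ) (n : ℕ) (t : ℝ),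
      iteratedDeriv n (C1 (a • w + b • w')) t = a * iteratedDeriv n (C1 w) t + b * iteratedDeriv n (C1 w') t :=
    fun a b w w' n t => iteratedDeriv_firstVariation_linear δ S a b w w' n t
  have hL0 : ∀ (a b : ℝ) (w w' : Fin 6 → Fin 3 → ℝ) (t : ℝ), C1 (a • w + b • w') t = a * C1 w t + b * C1 w' t := by
    intro a b w w' t
    have h := hL a b w w' 0 t
    simpa only [iteratedDeriv_zero] using h
  have hneg : ∀ (w : Fin 6 → Fin 3 → ℝ) (n : ℕ) (t : ℝ), iteratedDeriv n (C1 (-w)) t = -iteratedDeriv n (C1 w) t := by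
    intro w n t
    have h := hL (-1) 0 w w n t
    rw [show ((-1 : ℝ) • w + (0 : ℝ) • w) = -w by simp] at h
    rw [h]; ring
  have hzero : ∀ (w : Fin 6 → Fin 3 → ℝ) (n : ℕ) (t : ℝ), iteratedDeriv n (C1 ((0 : ℝ) • w + (0 : ℝ) • w)) t = 0 := by
    intro w n t; rw [hL]; ring
  -- the convex data for the alternative
  let X := Fin 6 → Fin 3 → ℝ
  let C : Set X := {w | ∀ j, m j = 3 → C1 w (z j) = 0}
  let f : Fin r → X → ℝ := fun j w => if m j = 1 then -1 else iteratedDeriv (m j) c₀ (z j) * iteratedDeriv (m j - 2) (C1 w) (z j)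
  have hC : Convex ℝ C := by
    intro x hx y hy a b _ _ _ j hj
    show C1 (a • x + b • y) (z j) = 0
    rw [hL0, hx j hj, hy j hj]; ring
  have hf : ∀ j, ConvexOn ℝ C (f j) := by
    intro j
    refine ⟨hC, fun x _ y _ a b _ _ hab => le_of_eq ?_⟩
    by_cases h1 : m j = 1
    · simp only [f, h1, if_true, smul_eq_mul]
      calc (-1 : ℝ) = -(a + b) := by rw [hab]
        _ = a * -1 + b * -1 := by ring
    · simp only [f, h1, if_false, smul_eq_mul]
      rw [hL]; ring
  have hr : 0 < r := by
    rcases Nat.eq_zero_or_pos r with h | h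
    · subst h; simp at hm
    · exact h
  haveI : Nonempty (Fin r) := ⟨⟨0, hr⟩⟩
  by_cases hfeas : ∃ w ∈ C, ∀ j, f j w < 0
  · -- a shift realising every push: the primal opening #80
    obtain ⟨w, hwC, hw⟩ := hfeas
    left
    refine mem_twentyLocus_of_orderThree_pushes δ S hS z hρ hsep m hm1 hm3 hm hvan htop w ?_ ?_ ?_
    · intro j hj
      have h := hw j
      simp only [f, hj, show (2 : ℕ) ≠ 1 by norm_num, if_false, show (2 : ℕ) - 2 = 0 from rfl, iteratedDeriv_zero] at h
      exact h
    · intro j hj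
      exact hwC j hj
    · intro j hj
      have h := hw j
      simp only [f, hj, show (3 : ℕ) ≠ 1 by norm_num, if_false, show (3 : ℕ) - 2 = 1 from rfl, iteratedDeriv_one] at h
      exact h
  · -- the alternative: multipliers
    obtain ⟨lam, hl0, hlne, hle⟩ :=
      (Literature.Analysis.Convex.ConvexInequalityAlternative.not_exists_forall_lt_iff hC hf).1 hfeas
    right
    -- the zero shift lies in `C` and kills every non-simple row, so the simple multipliers vanish
    have h0C : ((0 : ℝ) • (0 : X) + (0 : ℝ) • (0 : X)) ∈ C := fun j _ => hzero 0 0 (z j)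
    have hsimple : ∀ j, m j = 1 → lam j = 0 := by
      intro j₀ hj₀
      have h := hle _ h0C
      have hterm : ∀ j, lam j * f j ((0 : ℝ) • (0 : X) + (0 : ℝ) • (0 : X)) = -(if m j = 1 then lam j else 0) := by
        intro j
        by_cases h1 : m j = 1
        · simp only [f, h1, if_true]; ring
        · simp only [f, h1, if_false, hzero]; ring
      rw [Finset.sum_congr rfl (fun j _ => hterm j), Finset.sum_neg_distrib] at h
      have hle' : (∑ j, (if m j = 1 then lam j else 0)) ≤ 0 := by linarith
      have hge : (if m j₀ = 1 then lam j₀ else 0) ≤ ∑ j, (if m j = 1 then lam j else 0) :=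
        Finset.single_le_sum (f := fun j => if m j = 1 then lam j else 0)
          (fun j _ => by
            show 0 ≤ (if m j = 1 then lam j else 0)
            split_ifs
            · exact hl0 j
            · exact le_rfl) (Finset.mem_univ j₀)
      rw [if_pos hj₀] at hge
      exact le_antisymm (by linarith) (hl0 j₀)
    refine ⟨lam, hl0, hlne, hsimple, fun w hwC => ?_⟩
    -- on `C` (a subspace) the combination is `≥ 0` at `w` and at `−w`, hence `= 0`
    have hwC' : w ∈ C := hwC
    have hnwC : -w ∈ C := by
      intro j hj
      show C1 (-w) (z j) = 0
      have h := hneg w 0 (z j)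
      simp only [iteratedDeriv_zero] at h
      have h' : C1 w (z j) = 0 := hwC j hj
      rw [h, h', neg_zero]
    have hid : ∀ v : X, ∑ j, lam j * f j v = ∑ j, lam j * (iteratedDeriv (m j) c₀ (z j) * iteratedDeriv (m j - 2) (C1 v) (z j)) := by
      intro v
      refine Finset.sum_congr rfl fun j _ => ?_
      by_cases h1 : m j = 1
      · rw [hsimple j h1, zero_mul, zero_mul]
      · simp only [f, h1, if_false]
    have h1 := hle w hwC'
    have h2 := hle (-w) hnwC
    rw [hid] at h1 h2
    have hodd : ∑ j, lam j * (iteratedDeriv (m j) c₀ (z j) * iteratedDeriv (m j - 2) (C1 (-w)) (z j))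
        = -∑ j, lam j * (iteratedDeriv (m j) c₀ (z j) * iteratedDeriv (m j - 2) (C1 w) (z j)) := by
      rw [← Finset.sum_neg_distrib]
      refine Finset.sum_congr rfl fun j _ => ?_
      rw [hneg]; ring
    rw [hodd] at h2
    show ∑ j, lam j * (iteratedDeriv (m j) c₀ (z j) * iteratedDeriv (m j - 2) (C1 w) (z j)) = 0
    linarith

end Summit.ValiantsHypothesis.ValiantsHypothesis.Theorems.LacunarySymmetroidMatrixDescartes.WallBubbling
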